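import Mathlib.LinearAlgebra.RootSystem.GeckConstruction.Basis
import Mathlib.Algebra.Lie.DirectSum
import Literature.LinearAlgebra.RootSystem.Components
import Literature.NumberTheory.Automorphic.RootDatumBaseChange
import Literature.Algebra.Lie.RootSpaceBracket
import Literature.NumberTheory.Automorphic.ChevalleyData
import HarnessLib

/-!
# The semisimple Lie algebra of a reduced root datum, with root vectors (Chevalley system)

Trunk T-AUTOMORPHIC (G25 AutomorphicL); the Lie-algebra input of Chevalley's existence theorem
(`Literature.NumberTheory.Automorphic.chevalley_existence`, Springer, *Linear Algebraic
Groups*, 2nd ed., 10.1.1; Bourbaki, *Lie* VIII §2, §4). For a reduced root datum `P` over `ℤ`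
with base `b`, finitely many roots and finitely generated weight lattice, over an algebraically
closed field `k` of characteristic zero, we **construct a Chevalley system**
(`IsChevalleySystem`, `ChevalleyData.lean`): a finite-dimensional Lie algebra `ChevLie k P b`
with Cartan elements `hG s` (`s` simple) and root vectors `eG α` (`α ∈ Φ`) satisfying the
Chevalley relations, forming a basis, and generated by the `hG s`, `eG (±α_s)`
(`isChevalleySystem`, `exists_isChevalleySystem`). Construction:

* the root system `Pk` of `P` over `k` and its base `bk` (`RootDatumBaseChange.lean`), its
  irreducible components `c` and their irreducible root systems with bases
  (`Literature/LinearAlgebra/RootSystem/Components.lean`);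
* for each component, Mathlib's **Geck construction** `GeckLie k P b c` with its
  `LieAlgebra.Basis` and the equivalence `geckEquiv` of its root system with the component
  (`RootPairing.GeckConstruction.equivRootSystem`), whence weights `wtW`, root vectors `eC`
  chosen from `sl₂`-triples (`IsKilling.exists_isSl2Triple_of_weight_isNonZero`), the relations
  (`lie_hC_eC`, `lie_eC_negC`, `exists_lie_eC_eC_eq_smul`, `lie_eC_eC_eq_zero`), the Cartan
  identity `h_α = ∑ c_{α s} h_s` through the coweight map (`coroot_wtW_eq_sum`), generation by
  simple root vectors (`eC_mem_lieSpan`, from `[𝔤_α, 𝔤_β] ≠ 0`, `RootSpaceBracket.lean`, and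
  `RootPairing.Base.induction_add`) and the basis `(h_s, e_α)` (`basisC`);
* the direct sum over the components (`ChevLie`, Mathlib `DirectSum.lieAlgebra`).

Everything is proved; the statements are [folklore].

## Mathlib

`RootPairing.GeckConstruction.{lieAlgebra, basis, equivRootSystem}`, `LieAlgebra.Basis`,
`LieAlgebra.IsKilling.{rootSystem, coroot, exists_isSl2Triple_of_weight_isNonZero,
lie_eq_smul_of_mem_rootSpace, finrank_rootSpace_eq_one}`, `LieModule.iSup_genWeightSpace_eq_top'`,
`DirectSum.lieAlgebraOf`, `DFinsupp.linearIndependent_single`. The Geck algebra is used only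
through its `Basis` and `equivRootSystem`; its definition is sealed (`attribute [irreducible]`)
to keep unification away from spaces of matrices.
-/

noncomputable section

open Module Set Function LieAlgebra LieModule

namespace Literature.NumberTheory.Automorphic

namespace ChevalleySystem

open Literature.LinearAlgebra.RootSystem Literature.LinearAlgebra.RootSystem.Base
  Literature.NumberTheory.Automorphic.RootDatumBaseChange Literature.Algebra.Lie

variable (k : Type*) [Field k] [CharZero k] [IsAlgClosed k]
variable {ι X Y : Type*} [AddCommGroup X] [AddCommGroup Y] [Fintype ι] [DecidableEq ι]
  [Module.Finite ℤ X] (P : RootPairing ι ℤ X Y) [P.IsReduced] (b : P.Base)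

/-- The root system of the root datum over `k`. [folklore] -/
def Pk : RootPairing ι k (Submodule.span k (range (baseChange P k).root))
    (Submodule.span k (range (baseChange P k).coroot)) := rootSystemOf P k

/-- `Pk` is a root system. [folklore] -/
instance : (Pk k P).IsRootSystem := by unfold Pk; infer_instance
/-- `Pk` is crystallographic. [folklore] -/
instance : (Pk k P).IsCrystallographic := by unfold Pk; infer_instance
/-- `Pk` is reduced. [folklore] -/
instance : (Pk k P).IsReduced := by unfold Pk; infer_instance

/-- The base of `Pk` induced by `b`. [folklore] -/
def bk : (Pk k P).Base := by unfold Pk; exact baseOf P k b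

omit [IsAlgClosed k] [DecidableEq ι] [P.IsReduced] in
/-- The pairings of `Pk` are those of `P`. [folklore] -/
lemma Pk_pairing (i j : ι) : (Pk k P).pairing i j = (P.pairing i j : k) := rootSystemOf_pairing P k i j

omit [IsAlgClosed k] [DecidableEq ι] [P.IsReduced] in
/-- The reflection permutations of `Pk` are those of `P`. [folklore] -/
lemma Pk_reflectionPerm : (Pk k P).reflectionPerm = P.reflectionPerm := rfl

omit [IsAlgClosed k] [DecidableEq ι] [P.IsReduced] in
/-- The roots of `Pk` are the coordinate vectors of the roots of `P`. [folklore] -/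
lemma Pk_root_coe (i : ι) :
    (((Pk k P).root i : Submodule.span k (range (baseChange P k).root)) : Fin (rk P) → k) =
      coordK P k (P.root i) := rfl

omit [IsAlgClosed k] [DecidableEq ι] [P.IsReduced] in
/-- The support of `bk` is that of `b`. [folklore] -/
lemma bk_support : (bk k P b).support = b.support := by
  unfold bk; rfl

variable (c : Comp (bk k P b))

attribute [local instance 100] LieRing.ofAssociativeRing

open scoped Classical in
/-- **The Geck Lie algebra of the component `c`** (Mathlib `RootPairing.GeckConstruction`), as a
type. [folklore] -/
def GeckLie : Type _ := ↥(RootPairing.GeckConstruction.lieAlgebra (compBase (bk k P b) c))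

open scoped Classical in
/-- Lie ring structure. [folklore] -/
instance : LieRing (GeckLie k P b c) :=
  inferInstanceAs (LieRing ↥(RootPairing.GeckConstruction.lieAlgebra (compBase (bk k P b) c)))

open scoped Classical in
/-- Lie algebra structure. [folklore] -/
instance : LieAlgebra k (GeckLie k P b c) :=
  inferInstanceAs (LieAlgebra k ↥(RootPairing.GeckConstruction.lieAlgebra (compBase (bk k P b) c)))

open scoped Classical in
/-- Additive group / module structure come with the Lie ring; finite-dimensionality. [folklore] -/
instance : FiniteDimensional k (GeckLie k P b c) :=
  inferInstanceAs (FiniteDimensional k ↥(RootPairing.GeckConstruction.lieAlgebra (compBase (bk k P b) c)))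

open scoped Classical in
/-- The Killing form is non-degenerate (Geck's algebra has trivial radical; Cartan's criterion).
[folklore] -/
instance : LieAlgebra.IsKilling k (GeckLie k P b c) :=
  inferInstanceAs (LieAlgebra.IsKilling k ↥(RootPairing.GeckConstruction.lieAlgebra (compBase (bk k P b) c)))

open scoped Classical in
/-- The distinguished `LieAlgebra.Basis` of the Geck algebra. [folklore] -/
def geckBasis : LieAlgebra.Basis (compBase (bk k P b) c).support k (GeckLie k P b c) :=
  RootPairing.GeckConstruction.basis (compBase (bk k P b) c)

/-- The Cartan subalgebra. [folklore] -/
abbrev cartan : LieSubalgebra k (GeckLie k P b c) := (geckBasis k P b c).cartan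

/-- It is a Cartan subalgebra. [folklore] -/
instance : (cartan k P b c).IsCartanSubalgebra := inferInstance

/-- Triangularizability (algebraically closed field). [folklore] -/
instance : LieModule.IsTriangularizable k (cartan k P b c) (GeckLie k P b c) := inferInstance

open scoped Classical in
/-- **The Geck equivalence** between the component root system and the root system of the Geck
algebra. [folklore] -/
def geckEquiv : (compSystem (bk k P b) c).Equiv (IsKilling.rootSystem (cartan k P b c)) :=
  RootPairing.GeckConstruction.equivRootSystem (compBase (bk k P b) c)

/- From here on the Geck algebra is used only through `geckBasis` and `geckEquiv`: seal the
definition so that unification never unfolds it to a space of matrices. -/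
attribute [irreducible] GeckLie

/-! ### Weights and root vectors in the Geck algebra of a component -/

section Component

variable {k P b}

/-- The root of `L_c` attached to a root index of the component. [folklore] -/
def wtC (i : CompIdx (bk k P b) c) : ↥(cartan k P b c).root := (geckEquiv k P b c).indexEquiv i

/-- As a weight of the Cartan subalgebra on `L_c`. [folklore] -/
def wtW (i : CompIdx (bk k P b) c) : Weight k (cartan k P b c) (GeckLie k P b c) := (wtC c i).1

/-- The roots of `L_c` are non-zero weights. [folklore] -/
lemma wtW_isNonZero (i : CompIdx (bk k P b) c) : (wtW c i).IsNonZero :=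
  LieSubalgebra.isNonZero_coe_root (wtC c i)

/-- The linear form of `wtW i` is the image of the root `α_i` under the Geck equivalence.
[folklore] -/
lemma coe_wtW (i : CompIdx (bk k P b) c) :
    ((wtW c i : Weight k _ _) : (cartan k P b c) →ₗ[k] k) =
      (geckEquiv k P b c).weightMap ((compSystem (bk k P b) c).root i) := by
  rw [RootPairing.Hom.root_weightMap_apply]
  rfl

/-- **`wt (-α) = -wt α`.** [folklore] -/
lemma wtW_neg (i : CompIdx (bk k P b) c) :
    wtW c ((compSystem (bk k P b) c).reflectionPerm i i) = -wtW c i := by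
  apply Weight.ext
  intro x
  have h := coe_wtW c ((compSystem (bk k P b) c).reflectionPerm i i)
  rw [RootPairing.root_reflectionPerm, RootPairing.reflection_apply_self, map_neg, ← coe_wtW] at h
  have hx := LinearMap.congr_fun h x
  simpa using hx

/-- Transpose identity of a morphism of root pairings: `⟨f m, x⟩_Q = ⟨m, fᵗ x⟩_P`. [folklore] -/
lemma toLinearMap_weightMap_apply {ι₁ ι₂ R M₁ N₁ M₂ N₂ : Type*} [CommRing R] [AddCommGroup M₁] [Module R M₁]
    [AddCommGroup N₁] [Module R N₁] [AddCommGroup M₂] [Module R M₂] [AddCommGroup N₂] [Module R N₂]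
    {P₁ : RootPairing ι₁ R M₁ N₁} {P₂ : RootPairing ι₂ R M₂ N₂} (f : RootPairing.Hom P₁ P₂)
    (m : M₁) (x : N₂) : P₂.toLinearMap (f.weightMap m) x = P₁.toLinearMap m (f.coweightMap x) := by
  have h := LinearMap.congr_fun (f.weight_coweight_transpose_apply (P := P₁) (Q := P₂) x) m
  rw [LinearMap.dualMap_apply] at h
  exact h

/-- **A morphism of root pairings preserves the pairings.** [folklore] -/
lemma pairing_indexEquiv {ι₁ ι₂ R M₁ N₁ M₂ N₂ : Type*} [CommRing R] [AddCommGroup M₁] [Module R M₁]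
    [AddCommGroup N₁] [Module R N₁] [AddCommGroup M₂] [Module R M₂] [AddCommGroup N₂] [Module R N₂]
    {P₁ : RootPairing ι₁ R M₁ N₁} {P₂ : RootPairing ι₂ R M₂ N₂} (f : RootPairing.Hom P₁ P₂)
    (i j : ι₁) : P₂.pairing (f.indexEquiv i) (f.indexEquiv j) = P₁.pairing i j := by
  rw [← RootPairing.root_coroot_eq_pairing, ← RootPairing.Hom.root_weightMap_apply,
    toLinearMap_weightMap_apply, RootPairing.Hom.coroot_coweightMap_apply, Equiv.symm_apply_apply,
    RootPairing.root_coroot_eq_pairing]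

/-- **The pairings of the weights of `L_c` are the Cartan integers of `P`**:
`(wt α_i) (h_{α_j}) = ⟨α_i, α_j^∨⟩`. [folklore] -/
theorem wtW_apply_coroot (i j : CompIdx (bk k P b) c) :
    (wtW c i) (IsKilling.coroot (wtW c j)) = (P.pairing i j : k) := by
  have h := pairing_indexEquiv (geckEquiv k P b c).toHom i j
  rw [IsKilling.rootSystem_pairing_apply, compSystem_pairing, Pk_pairing] at h
  exact h

/-- The `sl₂`-triple of a root of `L_c` (Mathlib `exists_isSl2Triple_of_weight_isNonZero`).
[folklore] -/
def triple (i : CompIdx (bk k P b) c) : GeckLie k P b c × GeckLie k P b c × GeckLie k P b c :=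
  let h := IsKilling.exists_isSl2Triple_of_weight_isNonZero (wtW_isNonZero c i)
  (h.choose, h.choose_spec.choose, h.choose_spec.choose_spec.choose)

/-- Defining property of `triple`. [folklore] -/
lemma triple_spec (i : CompIdx (bk k P b) c) :
    IsSl2Triple (triple c i).1 (triple c i).2.1 (triple c i).2.2 ∧
      (triple c i).2.1 ∈ rootSpace (cartan k P b c) (wtW c i) ∧
      (triple c i).2.2 ∈ rootSpace (cartan k P b c) (-wtW c i) :=
  (IsKilling.exists_isSl2Triple_of_weight_isNonZero (wtW_isNonZero c i)).choose_spec.choose_spec.choose_spec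

/-- Positivity of a root of the component (with respect to `compBase`). [folklore] -/
abbrev IsPosC (i : CompIdx (bk k P b) c) : Prop := (compBase (bk k P b) c).IsPos i

/-- Negation of root indices of the component. [folklore] -/
abbrev negC (i : CompIdx (bk k P b) c) : CompIdx (bk k P b) c := (compSystem (bk k P b) c).reflectionPerm i i

omit [IsAlgClosed k] [DecidableEq ι] in
/-- `-(-i) = i`. [folklore] -/
@[simp] lemma negC_negC (i : CompIdx (bk k P b) c) : negC c (negC c i) = i := by
  letI := (compSystem (bk k P b) c).indexNeg
  exact neg_neg i

omit [IsAlgClosed k] in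
/-- Exactly one of `i`, `-i` is positive. [folklore] -/
lemma isPosC_negC_iff (i : CompIdx (bk k P b) c) : IsPosC c (negC c i) ↔ ¬ IsPosC c i :=
  RootPairing.Base.IsPos.neg_iff_not _ i

open scoped Classical in
/-- **The root vectors of `L_c`**: the `e` of the `sl₂`-triple of `α` for `α` positive, the `f` of
the triple of `-α` for `α` negative. [folklore] -/
def eC (i : CompIdx (bk k P b) c) : GeckLie k P b c :=
  if IsPosC c i then (triple c i).2.1 else (triple c (negC c i)).2.2

/-- **`e_α` spans... lies in the root space of `wt α`.** [folklore] -/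
theorem eC_mem_rootSpace (i : CompIdx (bk k P b) c) : eC c i ∈ rootSpace (cartan k P b c) (wtW c i) := by
  classical
  rw [eC]
  split_ifs with h
  · exact (triple_spec c i).2.1
  · have := (triple_spec c (negC c i)).2.2
    rwa [wtW_neg, Weight.coe_neg, neg_neg] at this

/-- The root vectors are non-zero. [folklore] -/
theorem eC_ne_zero (i : CompIdx (bk k P b) c) : eC c i ≠ 0 := by
  classical
  rw [eC]
  split_ifs with h
  · exact (triple_spec c i).1.e_ne_zero
  · exact (triple_spec c (negC c i)).1.f_ne_zero

/-- **`[e_α, e_{-α}] = h_α`** (the coroot of `wt α` in the Cartan subalgebra). [folklore] -/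
theorem lie_eC_negC (i : CompIdx (bk k P b) c) :
    ⁅eC c i, eC c (negC c i)⁆ = (IsKilling.coroot (wtW c i) : GeckLie k P b c) := by
  classical
  by_cases h : IsPosC c i
  · have hn : ¬ IsPosC c (negC c i) := fun h' => (isPosC_negC_iff c i).1 h' h
    rw [eC, if_pos h, eC, if_neg hn]
    simp only [negC_negC]
    obtain ⟨ht, he, hf⟩ := triple_spec c i
    rw [ht.lie_e_f]
    exact ht.h_eq_coroot (wtW_isNonZero c i) he hf
  · have hn : IsPosC c (negC c i) := (isPosC_negC_iff c i).2 h
    rw [eC, if_neg h, eC, if_pos hn]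
    obtain ⟨ht, he, hf⟩ := triple_spec c (negC c i)
    rw [← lie_skew, ht.lie_e_f, ht.h_eq_coroot (wtW_isNonZero c _) he hf, wtW_neg,
      IsKilling.coroot_neg]
    simp

/-- **`[h, e_α] = (wt α)(h) e_α`** for `h` in the Cartan subalgebra. [folklore] -/
theorem lie_cartan_eC (x : cartan k P b c) (i : CompIdx (bk k P b) c) :
    ⁅(x : GeckLie k P b c), eC c i⁆ = (wtW c i) x • eC c i :=
  IsKilling.lie_eq_smul_of_mem_rootSpace (eC_mem_rootSpace c i) x

/-- **The root space of `wt α` is the line spanned by `e_α`.** [folklore] -/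
theorem rootSpace_eq_span_eC (i : CompIdx (bk k P b) c) :
    (rootSpace (cartan k P b c) (wtW c i)).toSubmodule = k ∙ eC c i := by
  symm
  apply Submodule.eq_of_le_of_finrank_eq
  · rw [Submodule.span_singleton_le_iff_mem]
    exact eC_mem_rootSpace c i
  · rw [finrank_span_singleton (eC_ne_zero c i)]
    exact (IsKilling.finrank_rootSpace_eq_one _ (wtW_isNonZero c i)).symm

/-- Brackets of root vectors lie in the root space of the sum. [folklore] -/
theorem lie_eC_eC_mem (i j : CompIdx (bk k P b) c) :
    ⁅eC c i, eC c j⁆ ∈ rootSpace (cartan k P b c) (⇑(wtW c i) + ⇑(wtW c j)) :=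
  lie_mem_genWeightSpace_of_mem_genWeightSpace (eC_mem_rootSpace c i) (eC_mem_rootSpace c j)

/-- Additivity of `wt`: if `α_i + α_j = α_l` then `wt α_i + wt α_j = wt α_l`. [folklore] -/
lemma wtW_add {i j l : CompIdx (bk k P b) c}
    (h : P.root (i : ι) + P.root (j : ι) = P.root (l : ι)) :
    (⇑(wtW c i) + ⇑(wtW c j) : cartan k P b c → k) = ⇑(wtW c l) := by
  have h' : (compSystem (bk k P b) c).root i + (compSystem (bk k P b) c).root j =
      (compSystem (bk k P b) c).root l := by
    apply Subtype.ext
    apply Subtype.ext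
    change (((Pk k P).root i : Submodule.span k (range (baseChange P k).root)) : Fin (rk P) → k) +
      (((Pk k P).root j : Submodule.span k (range (baseChange P k).root)) : Fin (rk P) → k) =
      (((Pk k P).root l : Submodule.span k (range (baseChange P k).root)) : Fin (rk P) → k)
    rw [Pk_root_coe, Pk_root_coe, Pk_root_coe, ← map_add, h]
  funext x
  have := congrArg (fun f : (cartan k P b c) →ₗ[k] k => f x)
    (show ((wtW c i : Weight k _ _) : (cartan k P b c) →ₗ[k] k) + (wtW c j : Weight k _ _) =
      (wtW c l : Weight k _ _) by rw [coe_wtW, coe_wtW, coe_wtW, ← map_add, h'])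
  simpa using this

/-- **`[e_α, e_β] ∈ k e_{α+β}` when `α + β` is a root.** [folklore] -/
theorem exists_lie_eC_eC_eq_smul {i j l : CompIdx (bk k P b) c}
    (h : P.root (i : ι) + P.root (j : ι) = P.root (l : ι)) :
    ∃ t : k, ⁅eC c i, eC c j⁆ = t • eC c l := by
  have hmem : ⁅eC c i, eC c j⁆ ∈ (rootSpace (cartan k P b c) (wtW c l)).toSubmodule := by
    rw [← wtW_add c h]
    exact lie_eC_eC_mem c i j
  rw [rootSpace_eq_span_eC, Submodule.mem_span_singleton] at hmem
  obtain ⟨t, ht⟩ := hmem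
  exact ⟨t, ht.symm⟩

/-- The weight map of the Geck equivalence is injective. [folklore] -/
lemma geckEquiv_weightMap_injective : Function.Injective (geckEquiv k P b c).weightMap :=
  (geckEquiv k P b c).bijective_weightMap.1

/-- **`[e_α, e_β] = 0` when `α + β` is neither zero nor a root.** [folklore] -/
theorem lie_eC_eC_eq_zero {i j : CompIdx (bk k P b) c} (h0 : P.root (i : ι) + P.root (j : ι) ≠ 0)
    (hnot : P.root (i : ι) + P.root (j : ι) ∉ range P.root) : ⁅eC c i, eC c j⁆ = 0 := by
  by_contra hne
  -- the function `wt α_i + wt α_j` is a weight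
  set φ : cartan k P b c → k := ⇑(wtW c i) + ⇑(wtW c j) with hφ
  have hbot : genWeightSpace (GeckLie k P b c) φ ≠ ⊥ := by
    intro hb
    have := lie_eC_eC_mem c i j
    rw [← hφ] at this
    change ⁅eC c i, eC c j⁆ ∈ genWeightSpace (GeckLie k P b c) φ at this
    rw [hb] at this
    exact hne ((LieSubmodule.mem_bot _).1 this)
  let χ : Weight k (cartan k P b c) (GeckLie k P b c) := ⟨φ, hbot⟩
  have hχlin : ((χ : Weight k _ _) : (cartan k P b c) →ₗ[k] k) =
      (geckEquiv k P b c).weightMap ((compSystem (bk k P b) c).root i + (compSystem (bk k P b) c).root j) := by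
    rw [map_add, ← coe_wtW, ← coe_wtW]
    ext x
    rfl
  -- the sum of roots, in `P`, over `k` and in the component
  have hsum : ∀ {m : Submodule.span k (range (baseChange P k).root)} (hm : m ∈ compSpan (bk k P b) c),
      ((compSystem (bk k P b) c).root i + (compSystem (bk k P b) c).root j : compSpan (bk k P b) c) =
        ⟨m, hm⟩ ↔ coordK P k (P.root i + P.root j) = (m : Fin (rk P) → k) := by
    intro m hm
    rw [Subtype.ext_iff, Subtype.ext_iff]
    change (((Pk k P).root i : Submodule.span k _) : Fin (rk P) → k) + (((Pk k P).root j :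
      Submodule.span k _) : Fin (rk P) → k) = _ ↔ _
    rw [Pk_root_coe, Pk_root_coe, ← map_add]
  by_cases hz : χ.IsZero
  · -- then `α_i + α_j = 0`
    apply h0
    have h1 : ((χ : Weight k _ _) : (cartan k P b c) →ₗ[k] k) = 0 :=
      Weight.coe_toLinear_eq_zero_iff.2 hz
    rw [hχlin, ← map_zero (geckEquiv k P b c).weightMap] at h1
    have h2 := geckEquiv_weightMap_injective c h1
    have h3 := (hsum (Submodule.zero_mem _)).1 h2
    exact coordK_injective P k (by rw [h3, map_zero]; rfl)
  · -- then `χ` is a root of `L_c`, i.e. `wt α_l` for some `l`, and `α_i + α_j = α_l`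
    apply hnot
    let χr : ↥(cartan k P b c).root := ⟨χ, by simpa [LieSubalgebra.root] using hz⟩
    let l : CompIdx (bk k P b) c := (geckEquiv k P b c).indexEquiv.symm χr
    have hl : (geckEquiv k P b c).weightMap ((compSystem (bk k P b) c).root l) =
        ((χ : Weight k _ _) : (cartan k P b c) →ₗ[k] k) := by
      rw [RootPairing.Hom.root_weightMap_apply, Equiv.apply_symm_apply]
      rfl
    rw [hχlin] at hl
    have h2 := geckEquiv_weightMap_injective c hl
    refine ⟨l, ?_⟩
    have h3 := (hsum ((compSystem (bk k P b) c).root l).2).1 h2.symm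
    exact (coordK_injective P k (h3.trans rfl)).symm

/-! ### The Cartan elements and the basis of `L_c` -/

/-- The simple roots of the component, as a type. [folklore] -/
abbrev SuppC : Type _ := ↥(compBase (bk k P b) c).support

/-- **The Cartan elements `h_s = h_{α_s}` of `L_c`** (coroots of the simple roots). [folklore] -/
def hC (s : SuppC c) : GeckLie k P b c := (IsKilling.coroot (wtW c (s : CompIdx (bk k P b) c)) : GeckLie k P b c)

/-- `h_s` lies in the Cartan subalgebra. [folklore] -/
lemma hC_mem (s : SuppC c) : hC c s ∈ cartan k P b c := (IsKilling.coroot _).2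

/-- **`[h_s, h_t] = 0`.** [folklore] -/
theorem lie_hC_hC (s t : SuppC c) : ⁅hC c s, hC c t⁆ = 0 := by
  have := trivial_lie_zero (cartan k P b c) (cartan k P b c) (⟨hC c s, hC_mem c s⟩ : cartan k P b c)
    ⟨hC c t, hC_mem c t⟩
  exact congrArg Subtype.val this

/-- **`[h_s, e_α] = ⟨α, α_s^∨⟩ e_α`.** [folklore] -/
theorem lie_hC_eC (s : SuppC c) (i : CompIdx (bk k P b) c) :
    ⁅hC c s, eC c i⁆ = (P.pairing i s : k) • eC c i := by
  rw [hC, lie_cartan_eC, wtW_apply_coroot]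

/-- **`[e_α, e_β] ≠ 0` when `α + β` is a root** (`RootSpaceBracket.lean`). [folklore] -/
theorem lie_eC_eC_ne_zero {i j l : CompIdx (bk k P b) c}
    (h : P.root (i : ι) + P.root (j : ι) = P.root (l : ι)) : ⁅eC c i, eC c j⁆ ≠ 0 := by
  refine lie_ne_zero_of_mem_rootSpace (wtW_isNonZero c i) (wtW_isNonZero c j) ?_
    (eC_mem_rootSpace c i) (eC_ne_zero c i) (eC_mem_rootSpace c j) (eC_ne_zero c j)
  rw [wtW_add c h]
  exact (wtW c l).genWeightSpace_ne_bot

omit [IsAlgClosed k] [DecidableEq ι] in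
/-- Sums of roots in `P` and in the component. [folklore] -/
lemma compRoot_add_iff {i j l : CompIdx (bk k P b) c} :
    (compSystem (bk k P b) c).root i + (compSystem (bk k P b) c).root j =
      (compSystem (bk k P b) c).root l ↔ P.root (i : ι) + P.root (j : ι) = P.root (l : ι) := by
  rw [Subtype.ext_iff, Subtype.ext_iff]
  change (((Pk k P).root i : Submodule.span k _) : Fin (rk P) → k) + (((Pk k P).root j :
    Submodule.span k _) : Fin (rk P) → k) = (((Pk k P).root l : Submodule.span k _) : Fin (rk P) → k) ↔ _
  rw [Pk_root_coe, Pk_root_coe, Pk_root_coe, ← map_add]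
  exact (coordK_injective P k).eq_iff

/-- **`L_c` is generated by the Cartan elements and the root vectors `e_{±α_s}` of the simple
roots**: every root vector lies in the Lie subalgebra they generate (induction on the height via
Mathlib `RootPairing.Base.induction_add`, using `[e_α, e_β] ≠ 0`). [folklore] -/
theorem eC_mem_lieSpan (i : CompIdx (bk k P b) c) :
    eC c i ∈ LieSubalgebra.lieSpan k (GeckLie k P b c)
      (range (hC c) ∪ ⋃ s : SuppC c, {eC c (s : CompIdx (bk k P b) c), eC c (negC c s)}) := by
  set S := LieSubalgebra.lieSpan k (GeckLie k P b c)
      (range (hC c) ∪ ⋃ s : SuppC c, {eC c (s : CompIdx (bk k P b) c), eC c (negC c s)}) with hS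
  have hgen : ∀ s : SuppC c, eC c (s : CompIdx (bk k P b) c) ∈ S ∧ eC c (negC c s) ∈ S := by
    intro s
    constructor <;> refine LieSubalgebra.subset_lieSpan (Or.inr ?_) <;>
      simp only [mem_iUnion, mem_insert_iff, mem_singleton_iff] <;> [exact ⟨s, Or.inl rfl⟩;
        exact ⟨s, Or.inr rfl⟩]
  -- the key step: closure under adding a simple root along roots
  have hstep : ∀ i j l : CompIdx (bk k P b) c, P.root (l : ι) = P.root (i : ι) + P.root (j : ι) →
      eC c i ∈ S → eC c j ∈ S → eC c l ∈ S := by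
    intro i j l h hi hj
    obtain ⟨t, ht⟩ := exists_lie_eC_eC_eq_smul c h.symm
    have ht0 : t ≠ 0 := by
      rintro rfl
      rw [zero_smul] at ht
      exact lie_eC_eC_ne_zero c h.symm ht
    have : eC c l = t⁻¹ • ⁅eC c i, eC c j⁆ := by
      rw [ht, smul_smul, inv_mul_cancel₀ ht0, one_smul]
    rw [this]
    exact S.smul_mem t⁻¹ (S.lie_mem hi hj)
  suffices h : eC c i ∈ S ∧ eC c (negC c i) ∈ S from h.1
  refine (compBase (bk k P b) c).induction_add i (p := fun i => eC c i ∈ S ∧ eC c (negC c i) ∈ S)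
    ?_ ?_ ?_
  · rintro j ⟨h1, h2⟩
    exact ⟨h2, by rw [negC_negC]; exact h1⟩
  · intro j hj
    exact hgen ⟨j, hj⟩
  · rintro i' j' l h ⟨hi1, hi2⟩ hj'
    have hP : P.root (l : ι) = P.root (i' : ι) + P.root (j' : ι) := ((compRoot_add_iff c).1 h.symm).symm
    refine ⟨hstep i' j' l hP hi1 (hgen ⟨j', hj'⟩).1, hstep (negC c i') (negC c j') (negC c l) ?_ hi2
      (hgen ⟨j', hj'⟩).2⟩
    change P.root (P.reflectionPerm l l) = P.root (P.reflectionPerm i' i') + P.root (P.reflectionPerm j' j')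
    rw [RootPairing.root_reflectionPerm, RootPairing.root_reflectionPerm, RootPairing.root_reflectionPerm,
      RootPairing.reflection_apply_self, RootPairing.reflection_apply_self,
      RootPairing.reflection_apply_self, hP, neg_add]

/-! ### The Cartan identity `h_α = ∑ corootCoord α s • h_s` and the bases -/

omit [IsAlgClosed k] [DecidableEq ι] [P.IsReduced] in
/-- The pairing of `Pk`, unfolded. [folklore] -/
lemma Pk_toLinearMap_apply (x : Submodule.span k (range (baseChange P k).root))
    (y : Submodule.span k (range (baseChange P k).coroot)) :
    (Pk k P).toLinearMap x y = (y : Module.Dual k (Fin (rk P) → k)) (x : Fin (rk P) → k) := by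
  have h := RootPairing.restrictScalars_toLinearMap_apply_apply (baseChange P k) k x y
  rw [Algebra.algebraMap_self, RingHom.id_apply] at h
  exact h

omit [IsAlgClosed k] [DecidableEq ι] [P.IsReduced] in
/-- The coroot functionals of `Pk`. [folklore] -/
lemma Pk_coroot_coe (j : ι) :
    (((Pk k P).coroot j : Submodule.span k (range (baseChange P k).coroot)) :
      Module.Dual k (Fin (rk P) → k)) = cocoordK P k (P.coroot j) := rfl

/-- The coweights of `P` act on `M_c` (restriction of the coroot functional). [folklore] -/
def coweightRes : Y →+ Module.Dual k (compSpan (bk k P b) c) where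
  toFun y := (cocoordK P k y).comp ((Submodule.span k (range (baseChange P k).root)).subtype.comp
    (compSpan (bk k P b) c).subtype)
  map_zero' := by ext; simp
  map_add' y y' := by ext; simp

omit [IsAlgClosed k] [DecidableEq ι] [P.IsReduced] in
/-- `coweightRes (α_j^∨) = compCoroot j`. [folklore] -/
lemma coweightRes_coroot (j : ι) : coweightRes c (P.coroot j) = compCoroot (bk k P b) c j := by
  ext x
  change cocoordK P k (P.coroot j) ((x : Submodule.span k _) : Fin (rk P) → k) = (Pk k P).coroot' j x
  rw [RootPairing.coroot', LinearMap.flip_apply, Pk_toLinearMap_apply, Pk_coroot_coe]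

omit [IsAlgClosed k] [DecidableEq ι] [P.IsReduced] in
/-- **The coroot functional of the component is the integer combination of the simple ones**
(and the coefficients outside the component do not contribute). [folklore] -/
theorem compCoroot_eq_sum (i : ι) :
    compCoroot (bk k P b) c i = ∑ s : b.support, (corootCoord P b i s : k) • compCoroot (bk k P b) c s := by
  have h := congrArg (coweightRes c) (sum_corootCoord_smul P b i)
  rw [map_sum, coweightRes_coroot] at h
  rw [← h]
  refine Finset.sum_congr rfl fun s _ => ?_
  rw [map_zsmul, coweightRes_coroot]
  exact (Int.cast_smul_eq_zsmul k _ _).symm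

/-- The simple roots of the component, seen in `b.support`. [folklore] -/
def suppIncl (s : SuppC c) : b.support :=
  ⟨((s : CompIdx (bk k P b) c) : ι), by rw [← bk_support k P b]; exact (mem_compSupport _ c).1 s.2⟩

omit [IsAlgClosed k] in
/-- `suppIncl` is injective. [folklore] -/
lemma suppIncl_injective : Function.Injective (suppIncl c) := by
  intro s t h
  have h' := Subtype.ext_iff.1 h
  exact Subtype.ext (Subtype.ext h')

/-- **The Cartan identity in `L_c`**: `h_{α_i} = ∑_s corootCoord i s • h_s` over the simple
roots `s` of the component. [folklore] -/
theorem coroot_wtW_eq_sum (i : CompIdx (bk k P b) c) :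
    IsKilling.coroot (wtW c i) =
      ∑ s : SuppC c, (corootCoord P b i (suppIncl c s) : k) • IsKilling.coroot (wtW c (s : CompIdx (bk k P b) c)) := by
  -- apply the (injective) coweight map of the Geck equivalence
  apply (geckEquiv k P b c).bijective_coweightMap.1
  have hcw : ∀ j : CompIdx (bk k P b) c, (geckEquiv k P b c).coweightMap (IsKilling.coroot (wtW c j)) =
      compCoroot (bk k P b) c j := by
    intro j
    have := RootPairing.Hom.coroot_coweightMap_apply (compSystem (bk k P b) c)
      (IsKilling.rootSystem (cartan k P b c)) (wtC c j) (geckEquiv k P b c).toHom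
    rw [IsKilling.rootSystem_coroot_apply] at this
    rw [wtW, this, wtC, Equiv.symm_apply_apply]
    rfl
  rw [hcw, map_sum, compCoroot_eq_sum]
  simp_rw [map_smul, hcw]
  -- reindex the sum over `b.support`: only the simple roots of `c` contribute
  classical
  rw [← Finset.sum_subset (Finset.subset_univ (Finset.univ.image (suppIncl c)))]
  · rw [Finset.sum_image (fun s _ t _ h => suppIncl_injective c h)]
    rfl
  · intro s _ hs
    have hsc : rootComp (bk k P b) (s : ι) ≠ c := by
      intro h
      apply hs
      rw [Finset.mem_image]
      refine ⟨⟨⟨(s : ι), h⟩, ?_⟩, Finset.mem_univ _, Subtype.ext rfl⟩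
      exact (mem_compSupport _ c).2 (by rw [bk_support]; exact s.2)
    rw [compCoroot_eq_zero_of_ne _ c hsc, smul_zero]

/-- `[e_α, e_{-α}] = ∑_s corootCoord α s • h_s`. [folklore] -/
theorem lie_eC_negC_eq_sum (i : CompIdx (bk k P b) c) :
    ⁅eC c i, eC c (negC c i)⁆ = ∑ s : SuppC c, (corootCoord P b i (suppIncl c s) : k) • hC c s := by
  rw [lie_eC_negC, coroot_wtW_eq_sum, AddSubmonoidClass.coe_finsetSum]
  rfl

/-! ### Bases -/

/-- **The `h_s` are linearly independent** (their images under the coweight map of the Geck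
equivalence are the simple coroot functionals). [folklore] -/
theorem linearIndependent_coroot_wtW :
    LinearIndependent k fun s : SuppC c => IsKilling.coroot (wtW c (s : CompIdx (bk k P b) c)) := by
  apply LinearIndependent.of_comp (geckEquiv k P b c).coweightMap
  have h : (geckEquiv k P b c).coweightMap ∘ (fun s : SuppC c => IsKilling.coroot (wtW c (s : CompIdx (bk k P b) c))) =
      fun s : SuppC c => (compSystem (bk k P b) c).coroot (s : CompIdx (bk k P b) c) := by
    funext s
    have := RootPairing.Hom.coroot_coweightMap_apply (compSystem (bk k P b) c)
      (IsKilling.rootSystem (cartan k P b c)) (wtC c s) (geckEquiv k P b c).toHom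
    rw [IsKilling.rootSystem_coroot_apply] at this
    simp only [Function.comp_apply, wtW]
    rw [this, wtC, Equiv.symm_apply_apply]
  rw [h]
  exact (compBase (bk k P b) c).linearIndepOn_coroot

/-- `dim H = #(simple roots of c)`. [folklore] -/
theorem finrank_cartan_eq : finrank k (cartan k P b c) = Fintype.card (SuppC c) := by
  have e := LinearEquiv.ofBijective (geckEquiv k P b c).coweightMap (geckEquiv k P b c).bijective_coweightMap
  rw [e.finrank_eq]
  refine (Subspace.dual_finrank_eq (K := k) (V := compSpan (bk k P b) c)).trans ?_
  rw [finrank_eq_card_basis (compBase (bk k P b) c).toWeightBasis]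

/-- **The basis `(h_s)` of the Cartan subalgebra.** [folklore] -/
def cartanBasis : Module.Basis (SuppC c) k (cartan k P b c) :=
  basisOfLinearIndependentOfCardEqFinrank' _ (linearIndependent_coroot_wtW c) (finrank_cartan_eq c).symm

/-- The vectors of `cartanBasis` are the `h_s`. [folklore] -/
@[simp] lemma coe_cartanBasis (s : SuppC c) : ((cartanBasis c s : cartan k P b c) : GeckLie k P b c) = hC c s := by
  rw [cartanBasis, coe_basisOfLinearIndependentOfCardEqFinrank']
  rfl

/-- `wt` is injective on root indices. [folklore] -/
lemma wtW_injective : Function.Injective (wtW c) := by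
  intro i j h
  have h' : wtC c i = wtC c j := Subtype.ext h
  exact (geckEquiv k P b c).indexEquiv.injective h'

/-- **The root vectors `e_α` are linearly independent** (they lie in independent root spaces).
[folklore] -/
theorem linearIndependent_eC : LinearIndependent k (eC c) := by
  refine iSupIndep.linearIndependent (fun i => (rootSpace (cartan k P b c) (wtW c i)).toSubmodule)
    ?_ (eC_mem_rootSpace c) (eC_ne_zero c)
  have h := (iSupIndep_genWeightSpace' k (cartan k P b c) (GeckLie k P b c)).comp (wtW_injective c)
  rw [← LieSubmodule.iSupIndep_toSubmodule] at h
  exact h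

/-- The Cartan elements `h_s` are linearly independent in `L_c`. [folklore] -/
theorem linearIndependent_hC : LinearIndependent k (hC c) := by
  have h := (cartanBasis c).linearIndependent.map' (cartan k P b c).toSubmodule.subtype
    (Submodule.ker_subtype _)
  have e : ⇑(cartan k P b c).toSubmodule.subtype ∘ ⇑(cartanBasis c) = hC c := by
    funext s
    rw [Function.comp_apply, Submodule.subtype_apply]
    exact coe_cartanBasis c s
  rwa [e] at h

/-- `[h, e_α]`-eigenvalue argument: the spans of the `h_s` and of the `e_α` meet trivially.
[folklore] -/
theorem disjoint_span_hC_span_eC :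
    Disjoint (Submodule.span k (range (hC c))) (Submodule.span k (range (eC c))) := by
  rw [Submodule.disjoint_def]
  intro v hvh hve
  -- `v ∈ H`
  have hvH : v ∈ cartan k P b c := by
    refine (Submodule.span_le.2 ?_) hvh
    rintro _ ⟨s, rfl⟩
    exact hC_mem c s
  -- write `v = ∑ t_i e_i` and bracket with `h ∈ H`
  obtain ⟨t, rfl⟩ := (Finsupp.mem_span_range_iff_exists_finsupp).1 hve
  have hzero : ∀ x : cartan k P b c, ∑ i ∈ t.support, (t i * wtW c i x) • eC c i = 0 := by
    intro x
    have h0 : ⁅(x : GeckLie k P b c), t.sum fun i a => a • eC c i⁆ = 0 := by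
      have := trivial_lie_zero (cartan k P b c) (cartan k P b c) x ⟨_, hvH⟩
      exact congrArg Subtype.val this
    rw [Finsupp.sum, lie_sum] at h0
    rw [← h0]
    refine Finset.sum_congr rfl fun i _ => ?_
    rw [lie_smul, lie_cartan_eC, smul_smul, mul_comm]
  -- independence of the `e_i` forces `t i * wt_i (x) = 0` for all `x`, hence `t i = 0`
  have hti : ∀ i ∈ t.support, ∀ x : cartan k P b c, t i * wtW c i x = 0 := by
    intro i hi x
    have := linearIndependent_iff'.1 (linearIndependent_eC c) t.support (fun i => t i * wtW c i x) (hzero x) i hi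
    exact this
  rw [Finsupp.sum]
  refine Finset.sum_eq_zero fun i hi => ?_
  obtain ⟨x, hx⟩ : ∃ x : cartan k P b c, wtW c i x ≠ 0 := by
    by_contra! h
    exact wtW_isNonZero c i (funext h)
  have := hti i hi x
  rw [mul_eq_zero] at this
  rcases this with h | h
  · rw [h, zero_smul]
  · exact absurd h hx

/-- The combined family `(h_s, e_α)` is linearly independent. [folklore] -/
theorem linearIndependent_hC_eC : LinearIndependent k (Sum.elim (hC c) (eC c)) := by
  rw [linearIndependent_sum]
  exact ⟨linearIndependent_hC c, linearIndependent_eC c, disjoint_span_hC_span_eC c⟩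

/-- **`L_c = span (h_s, e_α)`** (root space decomposition). [folklore] -/
theorem span_hC_eC_eq_top : Submodule.span k (range (Sum.elim (hC c) (eC c))) = ⊤ := by
  rw [eq_top_iff]
  have htop := LieModule.iSup_genWeightSpace_eq_top' k (cartan k P b c) (GeckLie k P b c)
  rw [← LieSubmodule.iSup_toSubmodule_eq_top] at htop
  rw [← htop, iSup_le_iff]
  intro χ
  by_cases hz : χ.IsZero
  · -- the zero weight space is `H`, spanned by the `h_s`
    have h1 : genWeightSpace (GeckLie k P b c) (χ : cartan k P b c → k) = rootSpace (cartan k P b c) 0 := by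
      rw [hz.eq]
    rw [h1, rootSpace_zero_eq]
    intro x hx
    change x ∈ cartan k P b c at hx
    let y : cartan k P b c := ⟨x, hx⟩
    change (y : GeckLie k P b c) ∈ _
    have hrepr := (cartanBasis c).sum_repr y
    have hy : (y : GeckLie k P b c) = ∑ s, (cartanBasis c).repr y s • hC c s := by
      conv_lhs => rw [← hrepr]
      rw [AddSubmonoidClass.coe_finsetSum]
      refine Finset.sum_congr rfl fun s _ => ?_
      rw [← coe_cartanBasis c s]
      rfl
    rw [hy]
    exact Submodule.sum_mem _ fun s _ => Submodule.smul_mem _ _ (Submodule.subset_span ⟨Sum.inl s, rfl⟩)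
  · -- a non-zero weight is a root `wt α_i`, whose space is the line of `e_i`
    let χr : ↥(cartan k P b c).root := ⟨χ, by simpa [LieSubalgebra.root] using hz⟩
    let i : CompIdx (bk k P b) c := (geckEquiv k P b c).indexEquiv.symm χr
    have hi : wtW c i = χ := by
      change ((geckEquiv k P b c).indexEquiv ((geckEquiv k P b c).indexEquiv.symm χr)).1 = χ
      rw [Equiv.apply_symm_apply]
    rw [← hi]
    change (rootSpace (cartan k P b c) (wtW c i)).toSubmodule ≤ _
    rw [rootSpace_eq_span_eC, Submodule.span_singleton_le_iff_mem]
    exact Submodule.subset_span ⟨Sum.inr i, rfl⟩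

/-- **The basis `(h_s, e_α)` of the Geck Lie algebra of the component.** [folklore] -/
def basisC : Module.Basis (SuppC c ⊕ CompIdx (bk k P b) c) k (GeckLie k P b c) :=
  Module.Basis.mk (linearIndependent_hC_eC c) (span_hC_eC_eq_top c).ge

/-- The vectors of `basisC`. [folklore] -/
@[simp] lemma coe_basisC : ⇑(basisC c) = Sum.elim (hC c) (eC c) := Module.Basis.coe_mk _ _

end Component

/-! ### The global Lie algebra: direct sum over the components -/

section Global

open DirectSum
open scoped Classical

/-- **The semisimple Lie algebra of the root datum over `k`**: the direct sum of the Geck algebras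
of the irreducible components. [folklore] -/
abbrev ChevLie : Type _ := ⨁ c : Comp (bk k P b), GeckLie k P b c

variable {k P b}

/-- The inclusion of a component, a morphism of Lie algebras. [folklore] -/
def inclC (c : Comp (bk k P b)) : GeckLie k P b c →ₗ⁅k⁆ ChevLie k P b :=
  DirectSum.lieAlgebraOf k (Comp (bk k P b)) (fun c => GeckLie k P b c) c

omit [IsAlgClosed k] in
/-- `inclC` is `DirectSum.of`. [folklore] -/
lemma inclC_apply (c : Comp (bk k P b)) (x : GeckLie k P b c) :
    inclC c x = DirectSum.of (fun c => GeckLie k P b c) c x := rfl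

omit [IsAlgClosed k] in
/-- **Brackets of inclusions from different components vanish.** [folklore] -/
lemma lie_inclC_ne {c c' : Comp (bk k P b)} (h : c ≠ c') (x : GeckLie k P b c) (y : GeckLie k P b c') :
    ⁅inclC c x, inclC c' y⁆ = 0 := by
  rw [inclC_apply, inclC_apply]
  exact DirectSum.lie_of_of_ne (fun c => GeckLie k P b c) h x y

omit [IsAlgClosed k] in
/-- Brackets of inclusions from the same component. [folklore] -/
lemma lie_inclC_same (c : Comp (bk k P b)) (x y : GeckLie k P b c) :
    ⁅inclC c x, inclC c y⁆ = inclC c ⁅x, y⁆ := (LieHom.map_lie (inclC c) x y).symm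

omit [IsAlgClosed k] in
/-- `inclC` is injective. [folklore] -/
lemma inclC_injective (c : Comp (bk k P b)) : Function.Injective (inclC (k := k) (P := P) (b := b) c) :=
  DirectSum.of_injective c

/-- A root index as an index of its component. [folklore] -/
def idxC (i : ι) : CompIdx (bk k P b) (rootComp (bk k P b) i) := ⟨i, rfl⟩

/-- A simple root of `b` is a simple root of `bk`. [folklore] -/
def suppK (s : b.support) : (bk k P b).support := ⟨s, by rw [bk_support]; exact s.2⟩

/-- A simple root (of `b`) as a simple root of its component. [folklore] -/
def simpC (s : b.support) : SuppC (comp (bk k P b) (suppK s)) :=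
  ⟨simpleIdx (bk k P b) _ (suppK s) rfl, (mem_compSupport _ _).2 (suppK (k := k) (P := P) s).2⟩

omit [IsAlgClosed k] in
/-- The underlying root index of `simpC s` is `s`. [folklore] -/
lemma coe_simpC (s : b.support) :
    (((simpC (k := k) (P := P) s).1 : CompIdx (bk k P b) (comp (bk k P b) (suppK s))) : ι) = s := rfl

variable (k P b)

/-- **The root vectors `e_α` of the global Lie algebra.** [folklore] -/
def eG (i : ι) : ChevLie k P b := inclC (rootComp (bk k P b) i) (eC _ (idxC i))

/-- **The Cartan elements `h_s` of the global Lie algebra.** [folklore] -/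
def hG (s : b.support) : ChevLie k P b := inclC _ (hC _ (simpC s))

variable {k P b}

/-- `e_α` for an index presented inside a component. [folklore] -/
lemma eG_eq_of_rootComp {c : Comp (bk k P b)} (i : CompIdx (bk k P b) c) :
    eG k P b (i : ι) = inclC c (eC c i) := by
  rcases i with ⟨i, rfl⟩
  rfl

/-- `h_s` for a simple root presented inside a component. [folklore] -/
lemma hG_eq_of_comp {c : Comp (bk k P b)} (s : SuppC c) :
    hG k P b (suppIncl c s) = inclC c (hC c s) := by
  have hc : comp (bk k P b) (suppK (suppIncl c s)) = c :=
    (rootComp_coe (bk k P b) (suppK (k := k) (P := P) (suppIncl c s))).symm.trans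
      ((s : CompIdx (bk k P b) c).2)
  have key : ∀ {c₁ c₂ : Comp (bk k P b)} (h : c₁ = c₂) (s₁ : SuppC c₁) (s₂ : SuppC c₂),
      ((s₁ : CompIdx (bk k P b) c₁) : ι) = ((s₂ : CompIdx (bk k P b) c₂) : ι) →
        inclC c₁ (hC c₁ s₁) = inclC c₂ (hC c₂ s₂) := by
    intro c₁ c₂ h s₁ s₂ hs
    subst h
    have : s₁ = s₂ := Subtype.ext (Subtype.ext hs)
    rw [this]
  exact key hc (simpC (suppIncl c s)) s rfl

/-- The components of `h_s` lie in the Cartan subalgebras. [folklore] -/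
lemma hG_apply_mem (s : b.support) (d : Comp (bk k P b)) :
    (hG k P b s : ⨁ c, GeckLie k P b c) d ∈ cartan k P b d := by
  change (DirectSum.of (fun c => GeckLie k P b c) _ (hC _ (simpC s))) d ∈ cartan k P b d
  by_cases h : comp (bk k P b) (suppK s) = d
  · subst h
    rw [DirectSum.of_eq_same]
    exact hC_mem _ _
  · have h0 : (DirectSum.of (fun c => GeckLie k P b c) (comp (bk k P b) (suppK s)) (hC _ (simpC s))) d = 0 :=
      DirectSum.of_eq_of_ne _ _ _ (Ne.symm h)
    rw [h0]
    exact (cartan k P b d).zero_mem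

/-- **`[h_s, h_t] = 0`.** [folklore] -/
theorem lie_hG_hG (s t : b.support) : ⁅hG k P b s, hG k P b t⁆ = 0 := by
  refine DFinsupp.ext fun d => ?_
  rw [DirectSum.bracket_apply, DirectSum.zero_apply]
  have := trivial_lie_zero (cartan k P b d) (cartan k P b d) ⟨_, hG_apply_mem s d⟩ ⟨_, hG_apply_mem t d⟩
  exact congrArg Subtype.val this

omit [IsAlgClosed k] in
/-- Sums over `b.support` of functions supported on the simple roots of one component.
[folklore] -/
lemma sum_support_eq_sum_suppC {M : Type*} [AddCommMonoid M] (c : Comp (bk k P b))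
    (f : b.support → M) (hf : ∀ s, comp (bk k P b) (suppK s) ≠ c → f s = 0) :
    ∑ s : b.support, f s = ∑ s' : SuppC c, f (suppIncl c s') := by
  rw [← Finset.sum_subset (Finset.subset_univ (Finset.univ.image (suppIncl c)))]
  · rw [Finset.sum_image (fun s _ t _ h => suppIncl_injective c h)]
  · intro s _ hs
    apply hf
    intro h
    apply hs
    rw [Finset.mem_image]
    refine ⟨⟨⟨(s : ι), by rw [← h]; exact rootComp_coe (bk k P b) (suppK s)⟩, ?_⟩,
      Finset.mem_univ _, Subtype.ext rfl⟩
    exact (mem_compSupport _ c).2 (suppK (k := k) (P := P) s).2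

omit [IsAlgClosed k] in
/-- A simple root of the component of `i`... presented as `suppIncl`. [folklore] -/
lemma exists_eq_suppIncl {c : Comp (bk k P b)} (s : b.support) (h : comp (bk k P b) (suppK s) = c) :
    ∃ s' : SuppC c, suppIncl c s' = s :=
  ⟨⟨⟨(s : ι), by rw [← h]; exact rootComp_coe (bk k P b) (suppK s)⟩,
    (mem_compSupport _ c).2 (suppK (k := k) (P := P) s).2⟩, Subtype.ext rfl⟩

/-- **`[h_s, e_α] = ⟨α, α_s^∨⟩ e_α`.** [folklore] -/
theorem lie_hG_eG (s : b.support) (i : ι) : ⁅hG k P b s, eG k P b i⁆ = (P.pairing i s : k) • eG k P b i := by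
  by_cases h : comp (bk k P b) (suppK s) = rootComp (bk k P b) i
  · obtain ⟨s', rfl⟩ := exists_eq_suppIncl s h
    rw [hG_eq_of_comp, show eG k P b i = inclC _ (eC _ (idxC i)) from rfl, lie_inclC_same, lie_hC_eC,
      map_smul]
    rfl
  · rw [hG, eG, lie_inclC_ne h]
    have h0 : P.pairing i s = 0 := by
      have := pairing_eq_zero_of_rootComp_ne (bk k P b) (i := (s : ι)) (j := i)
        (by rw [rootComp_coe]; exact h)
      rw [Pk_pairing] at this
      exact_mod_cast this
    rw [h0, Int.cast_zero, zero_smul]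

omit [IsAlgClosed k] in
/-- The integer coordinates of `α^∨` vanish outside the component of `α`. [folklore] -/
theorem corootCoord_eq_zero_of_comp_ne (i : ι) (s : b.support)
    (h : comp (bk k P b) (suppK s) ≠ rootComp (bk k P b) i) : corootCoord P b i s = 0 := by
  set c := comp (bk k P b) (suppK s) with hc
  -- the coroot functional of `α_i` on `M_c` vanishes and is the combination of the simple ones
  have h1 := compCoroot_eq_sum c i
  rw [compCoroot_eq_zero_of_ne _ c (Ne.symm h)] at h1
  rw [sum_support_eq_sum_suppC c _ (fun t ht => by
    rw [compCoroot_eq_zero_of_ne _ c (by rw [rootComp_coe]; exact ht), smul_zero])] at h1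
  have hli : LinearIndependent k fun s' : SuppC c => compCoroot (bk k P b) c (s' : CompIdx (bk k P b) c) :=
    linearIndepOn_compCoroot (bk k P b) c
  have hall := Fintype.linearIndependent_iff.1 hli (fun s' => (corootCoord P b i (suppIncl c s') : k)) h1.symm
  obtain ⟨s', hs'⟩ := exists_eq_suppIncl (k := k) (P := P) (b := b) s hc.symm
  have := hall s'
  rw [hs'] at this
  exact_mod_cast this

omit [IsAlgClosed k] [DecidableEq ι] in
/-- `-α` inside the component of `α`. [folklore] -/
lemma negC_idxC (i : ι) : ((negC (rootComp (bk k P b) i) (idxC i) : CompIdx (bk k P b) _) : ι) = P.reflectionPerm i i := rfl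

/-- **`[e_α, e_{-α}] = ∑_s c_{α s} h_s`.** [folklore] -/
theorem lie_eG_neg (i : ι) :
    ⁅eG k P b i, eG k P b (P.reflectionPerm i i)⁆ = ∑ s : b.support, (corootCoord P b i s : k) • hG k P b s := by
  set c := rootComp (bk k P b) i with hc
  rw [show eG k P b (P.reflectionPerm i i) = inclC c (eC c (negC c (idxC i))) from
    eG_eq_of_rootComp (negC c (idxC i)), show eG k P b i = inclC c (eC c (idxC i)) from rfl,
    lie_inclC_same, lie_eC_negC_eq_sum, map_sum]
  rw [sum_support_eq_sum_suppC c _ (fun s hs => by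
    rw [corootCoord_eq_zero_of_comp_ne i s hs, Int.cast_zero, zero_smul])]
  refine Finset.sum_congr rfl fun s' _ => ?_
  rw [map_smul, hG_eq_of_comp]
  rfl

omit [IsAlgClosed k] [DecidableEq ι] in
/-- Roots with a sum that is a root lie in the component of the sum. [folklore] -/
lemma rootComp_eq_of_add {i j l : ι} (h : P.root i + P.root j = P.root l)
    (hij : rootComp (bk k P b) i = rootComp (bk k P b) j) : rootComp (bk k P b) l = rootComp (bk k P b) i := by
  rw [rootComp_eq_iff]
  have hk : (Pk k P).root l = (Pk k P).root i + (Pk k P).root j := by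
    apply Subtype.ext
    change (((Pk k P).root l : Submodule.span k _) : Fin (rk P) → k) = (((Pk k P).root i :
      Submodule.span k _) : Fin (rk P) → k) + (((Pk k P).root j : Submodule.span k _) : Fin (rk P) → k)
    rw [Pk_root_coe, Pk_root_coe, Pk_root_coe, ← map_add, h]
  rw [hk]
  exact add_mem (root_mem_compSpan_rootComp _ i) (hij ▸ root_mem_compSpan_rootComp _ j)

omit [IsAlgClosed k] [DecidableEq ι] in
/-- Roots from different components never add up to a root. [folklore] -/
lemma rootComp_eq_of_add' {i j l : ι} (h : P.root i + P.root j = P.root l) :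
    rootComp (bk k P b) i = rootComp (bk k P b) j := by
  by_contra hij
  have hk : (Pk k P).root l = (Pk k P).root i + (Pk k P).root j := by
    apply Subtype.ext
    change (((Pk k P).root l : Submodule.span k _) : Fin (rk P) → k) = (((Pk k P).root i :
      Submodule.span k _) : Fin (rk P) → k) + (((Pk k P).root j : Submodule.span k _) : Fin (rk P) → k)
    rw [Pk_root_coe, Pk_root_coe, Pk_root_coe, ← map_add, h]
  -- a coordinate of `α_i` is non-zero; there `α_j` has coordinate zero, so `α_l` is supported
  -- in the component of `i`; symmetrically in that of `j`
  have key : ∀ {i j : ι}, rootComp (bk k P b) i ≠ rootComp (bk k P b) j →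
      (Pk k P).root l = (Pk k P).root i + (Pk k P).root j → rootComp (bk k P b) l = rootComp (bk k P b) i := by
    intro i j hij hk
    have hi := (mem_compSpan_iff (bk k P b)).1 (root_mem_compSpan_rootComp (bk k P b) i)
    have hj := (mem_compSpan_iff (bk k P b)).1 (root_mem_compSpan_rootComp (bk k P b) j)
    have hl := (mem_compSpan_iff (bk k P b)).1 (root_mem_compSpan_rootComp (bk k P b) l)
    obtain ⟨s, hs⟩ : ∃ s, (bk k P b).toWeightBasis.repr ((Pk k P).root i) s ≠ 0 := by
      by_contra! h0
      apply (Pk k P).ne_zero i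
      exact (bk k P b).toWeightBasis.repr.injective (by ext s; simpa using h0 s)
    have hjs : (bk k P b).toWeightBasis.repr ((Pk k P).root j) s = 0 := by
      by_contra h
      exact hij ((hi s hs).symm.trans (hj s h))
    have hls : (bk k P b).toWeightBasis.repr ((Pk k P).root l) s ≠ 0 := by
      rw [hk, map_add, Finsupp.add_apply, hjs, add_zero]; exact hs
    exact (hl s hls).symm.trans (hi s hs)
  exact hij ((key hij hk).symm.trans (key (Ne.symm hij) (by rw [hk, add_comm])))

/-- **`[e_α, e_β] ∈ kˣ e_{α+β}` when `α + β` is a root.** [folklore] -/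
theorem exists_lie_eG_eG_eq_smul (i j l : ι) (h : P.root i + P.root j = P.root l) :
    ∃ t : k, t ≠ 0 ∧ ⁅eG k P b i, eG k P b j⁆ = t • eG k P b l := by
  have hij : rootComp (bk k P b) i = rootComp (bk k P b) j := rootComp_eq_of_add' h
  set c := rootComp (bk k P b) i with hc
  have hl : rootComp (bk k P b) l = c := rootComp_eq_of_add h hij
  let i' : CompIdx (bk k P b) c := idxC i
  let j' : CompIdx (bk k P b) c := ⟨j, hij.symm⟩
  let l' : CompIdx (bk k P b) c := ⟨l, hl⟩
  obtain ⟨t, ht⟩ := exists_lie_eC_eC_eq_smul c (i := i') (j := j') (l := l') h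
  have ht0 : t ≠ 0 := by
    rintro rfl
    rw [zero_smul] at ht
    exact lie_eC_eC_ne_zero c (i := i') (j := j') (l := l') h ht
  refine ⟨t, ht0, ?_⟩
  rw [show eG k P b i = inclC c (eC c i') from rfl, show eG k P b j = inclC c (eC c j') from
    eG_eq_of_rootComp j', show eG k P b l = inclC c (eC c l') from eG_eq_of_rootComp l',
    lie_inclC_same, ht, map_smul]

/-- **`[e_α, e_β] = 0` when `α + β ∉ Φ ∪ {0}`.** [folklore] -/
theorem lie_eG_eG_eq_zero (i j : ι) (h0 : P.root i + P.root j ≠ 0) (hnot : P.root i + P.root j ∉ range P.root) :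
    ⁅eG k P b i, eG k P b j⁆ = 0 := by
  by_cases hij : rootComp (bk k P b) i = rootComp (bk k P b) j
  · set c := rootComp (bk k P b) i with hc
    let j' : CompIdx (bk k P b) c := ⟨j, hij.symm⟩
    rw [show eG k P b i = inclC c (eC c (idxC i)) from rfl, show eG k P b j = inclC c (eC c j') from
      eG_eq_of_rootComp j', lie_inclC_same, lie_eC_eC_eq_zero c (i := idxC i) (j := j') h0 hnot, map_zero]
  · rw [eG, eG, lie_inclC_ne hij]

/-! ### The global basis and generation -/

/-- The index map into the component bases. [folklore] -/
def gIdx : b.support ⊕ ι → Σ c : Comp (bk k P b), (SuppC c ⊕ CompIdx (bk k P b) c) :=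
  Sum.elim (fun s => ⟨comp (bk k P b) (suppK s), Sum.inl (simpC s)⟩)
    (fun i => ⟨rootComp (bk k P b) i, Sum.inr (idxC i)⟩)

omit [IsAlgClosed k] in
/-- `gIdx` is injective. [folklore] -/
lemma gIdx_injective : Function.Injective (gIdx (k := k) (P := P) (b := b)) := by
  rintro (s | i) (t | j) h
  · simp only [gIdx, Sum.elim_inl, Sigma.mk.injEq] at h
    obtain ⟨h1, h2⟩ := h
    congr 1
    apply Subtype.ext
    have h3 : ((simpC (k := k) (P := P) s).1.1 : ι) = ((simpC (k := k) (P := P) t).1.1 : ι) := by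
      have := h2
      revert this
      generalize simpC (k := k) (P := P) s = a
      generalize simpC (k := k) (P := P) t = a'
      revert a a'
      rw [h1]
      intro a a' haa
      cases haa
      rfl
    exact h3
  · simp only [gIdx, Sum.elim_inl, Sum.elim_inr, Sigma.mk.injEq] at h
    obtain ⟨h1, h2⟩ := h
    exfalso
    revert h2
    generalize simpC (k := k) (P := P) s = a
    generalize idxC (k := k) (P := P) (b := b) j = a'
    revert a a'
    rw [h1]
    intro a a' haa
    exact Sum.inl_ne_inr (eq_of_heq haa)
  · simp only [gIdx, Sum.elim_inl, Sum.elim_inr, Sigma.mk.injEq] at h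
    obtain ⟨h1, h2⟩ := h
    exfalso
    revert h2
    generalize idxC (k := k) (P := P) (b := b) i = a
    generalize simpC (k := k) (P := P) t = a'
    revert a a'
    rw [h1]
    intro a a' haa
    exact Sum.inr_ne_inl (eq_of_heq haa)
  · simp only [gIdx, Sum.elim_inr, Sigma.mk.injEq] at h
    obtain ⟨h1, h2⟩ := h
    have h3 : ((idxC (k := k) (P := P) (b := b) i).1 : ι) = (idxC (k := k) (P := P) (b := b) j).1 := by
      have := h2
      revert this
      generalize idxC (k := k) (P := P) (b := b) i = a
      generalize idxC (k := k) (P := P) (b := b) j = a'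
      revert a a'
      rw [h1]
      intro a a' haa
      cases haa
      rfl
    exact congrArg Sum.inr h3

/-- The component basis vectors, in the direct sum. [folklore] -/
lemma of_basisC_eq (x : Σ c : Comp (bk k P b), (SuppC c ⊕ CompIdx (bk k P b) c)) :
    DirectSum.of (fun c => GeckLie k P b c) x.1 (basisC x.1 x.2) ∈ range (Sum.elim (hG k P b) (eG k P b)) := by
  rcases x with ⟨c, s | i⟩
  · refine ⟨Sum.inl (suppIncl c s), ?_⟩
    rw [Sum.elim_inl, hG_eq_of_comp, coe_basisC, Sum.elim_inl]
    rfl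
  · refine ⟨Sum.inr (i : ι), ?_⟩
    rw [Sum.elim_inr, eG_eq_of_rootComp, coe_basisC, Sum.elim_inr]
    rfl

/-- **`(h_s, e_α)` is linearly independent in the global Lie algebra.** [folklore] -/
theorem linearIndependent_hG_eG : LinearIndependent k (Sum.elim (hG k P b) (eG k P b)) := by
  have hF := DFinsupp.linearIndependent_single (fun c => ⇑(basisC (k := k) (P := P) (b := b) c))
    (fun c => (basisC c).linearIndependent)
  have hcomp : (fun ix : Σ c : Comp (bk k P b), (SuppC c ⊕ CompIdx (bk k P b) c) =>
      DFinsupp.single ix.1 (basisC ix.1 ix.2)) ∘ gIdx = Sum.elim (hG k P b) (eG k P b) := by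
    funext x
    rcases x with s | i
    · simp only [Function.comp_apply, gIdx, Sum.elim_inl, coe_basisC]
      rfl
    · simp only [Function.comp_apply, gIdx, Sum.elim_inr, coe_basisC]
      rfl
  rw [← hcomp]
  exact hF.comp _ gIdx_injective

/-- **`(h_s, e_α)` spans the global Lie algebra.** [folklore] -/
theorem span_hG_eG_eq_top : Submodule.span k (range (Sum.elim (hG k P b) (eG k P b))) = ⊤ := by
  rw [eq_top_iff]
  intro x _
  rw [← DirectSum.sum_support_of x]
  refine Submodule.sum_mem _ fun c _ => ?_
  -- expand `x c` in the component basis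
  have hx : x c = ∑ y, (basisC c).repr (x c) y • basisC c y := ((basisC c).sum_repr (x c)).symm
  rw [hx, map_sum]
  refine Submodule.sum_mem _ fun y _ => ?_
  rw [← DirectSum.lof_eq_of k, map_smul, DirectSum.lof_eq_of]
  exact Submodule.smul_mem _ _ (Submodule.subset_span (of_basisC_eq ⟨c, y⟩))

/-- **Every root vector lies in the Lie subalgebra generated by the `h_s` and the `e_{±α_s}`.**
[folklore] -/
theorem eG_mem_lieSpan (i : ι) : eG k P b i ∈ LieSubalgebra.lieSpan k (ChevLie k P b)
    (range (hG k P b) ∪ ⋃ s : b.support, {eG k P b s, eG k P b (P.reflectionPerm s s)}) := by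
  set c := rootComp (bk k P b) i
  set S := LieSubalgebra.lieSpan k (ChevLie k P b)
    (range (hG k P b) ∪ ⋃ s : b.support, {eG k P b s, eG k P b (P.reflectionPerm s s)})
  have hle : LieSubalgebra.lieSpan k (GeckLie k P b c)
      (range (hC c) ∪ ⋃ s : SuppC c, {eC c (s : CompIdx (bk k P b) c), eC c (negC c s)}) ≤ S.comap (inclC c) := by
    rw [LieSubalgebra.lieSpan_le]
    rintro x (⟨s', rfl⟩ | hx)
    · change inclC c (hC c s') ∈ S
      rw [← hG_eq_of_comp]
      exact LieSubalgebra.subset_lieSpan (Or.inl ⟨_, rfl⟩)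
    · simp only [mem_iUnion, mem_insert_iff, mem_singleton_iff] at hx
      obtain ⟨s', rfl | rfl⟩ := hx
      · change inclC c (eC c s') ∈ S
        rw [← eG_eq_of_rootComp]
        refine LieSubalgebra.subset_lieSpan (Or.inr ?_)
        simp only [mem_iUnion, mem_insert_iff, mem_singleton_iff]
        exact ⟨suppIncl c s', Or.inl rfl⟩
      · change inclC c (eC c (negC c s')) ∈ S
        rw [← eG_eq_of_rootComp]
        refine LieSubalgebra.subset_lieSpan (Or.inr ?_)
        simp only [mem_iUnion, mem_insert_iff, mem_singleton_iff]
        exact ⟨suppIncl c s', Or.inr rfl⟩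
  exact hle (eC_mem_lieSpan c (idxC i))

variable (k P b)

/-- **The Lie algebra of the root datum with its Cartan elements and root vectors is a Chevalley
system** (Bourbaki *Lie* VIII §2, §4; here from Mathlib's Geck construction applied to the
irreducible components, `[𝔤_α, 𝔤_β] ≠ 0`, and the root space decomposition). [folklore] -/
theorem isChevalleySystem : IsChevalleySystem P b k (hG k P b) (eG k P b) where
  lie_h_h := lie_hG_hG
  lie_h_e := lie_hG_eG
  lie_e_neg := lie_eG_neg
  exists_lie_e_e_eq_smul := exists_lie_eG_eG_eq_smul
  lie_e_e_eq_zero := lie_eG_eG_eq_zero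
  linearIndependent := linearIndependent_hG_eG
  span_eq_top := span_hG_eG_eq_top
  e_mem_lieSpan := eG_mem_lieSpan

end Global

end ChevalleySystem

/-- **Existence of a Chevalley system for every reduced root datum** over an algebraically
closed field of characteristic zero, in a finite-dimensional Lie algebra. [folklore] -/
theorem exists_isChevalleySystem.{u, v, w, w'} (k : Type u) [Field k] [CharZero k] [IsAlgClosed k]
    {ι : Type v} {X : Type w} {Y : Type w'} [AddCommGroup X] [AddCommGroup Y] [Finite ι] [Module.Finite ℤ X]
    (P : RootPairing ι ℤ X Y) [P.IsReduced] (b : P.Base) :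
    ∃ (L : Type (max u v)) (_ : LieRing L) (_ : LieAlgebra k L) (h : b.support → L) (e : ι → L),
      IsChevalleySystem P b k h e := by
  classical
  have := Fintype.ofFinite ι
  exact ⟨_, _, _, _, _, ChevalleySystem.isChevalleySystem k P b⟩

end Literature.NumberTheory.Automorphic
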